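import Summits.Ventures.WeilGRH.TwistedTwoPrimeCells
import Literature.NumberTheory.LFunctions.WeilTwoPrimeMinorant
import HarnessLib

/-!
# Moment-method certificates for TWISTED Weil weights, VIII: the two-prime chain layer for an arbitrary even weight

Cell `rh-explicit`, WEIL TRACK — GRH ARM (namespace `Summit.Ventures.WeilGRH`).  The two-prime analogue of
`TwistedMomentChain.lean` / `TwistedMomentChainAbs.lean`: the chain layer of `WeilTwoPrimeMinorant.lean` (the `ζ` weight
`w₂₃`) redone ONCE for an ARBITRARY weight `W : ℝ → ℝ`, so that the signed two-prime cells of `TwistedTwoPrimeCells.lean`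
(`CellValidW23 c (twistWeight23 s₂ s₃)`) feed the same exact-moment machinery:

* `CellsOKW23 wL T cells W` — chain from `0` to `T` (`checkChain₂₃`), every cell `CellValidW23 · W`, tail level
  `wL ≤ W(t)` for `|t| ≥ T` (produced by the Boolean checker of file VII: `cellsOKW23_of_checkCellsZS23`, file IX);
* for `γ = cellsGamma₂₃ wL cells` (the SAME `γ` as on the `ζ` side, so `cellsMomentQ₂₃`, `cellsAbsMomentQ₂₃`,
  `cellsBndSumQ₂₃`, `cellsBndMaxQ₂₃` are reused verbatim): `level_sub_cellsGamma₂₃_leW` (`wL − γ ≤ W`, `W` even),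
  `cellsGamma₂₃_eq_zeroW`, `integral_cellsGamma₂₃_mul_powW` (proofs verbatim from the `ζ` file, `Valid ↦ CellValidW23`);
  the `|γ|` bounds and `cellsOKW23_of_checkCellsZS23` are in the continuation file `TwistedTwoPrimeChainAbs.lean`.

Everything here is PROVED; no named facts, nothing about zeros of any `L`-function.
-/

noncomputable section

open Complex Filter Set MeasureTheory
open scoped Real Topology

namespace Summit.Ventures.WeilGRH

open Literature.NumberTheory.LFunctions
open Literature.Analysis.ValidatedNumerics.Numerics
open Literature.Analysis.SpecialFunctions

/-! ## Valid chains for a weight `W` -/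

/-- A valid chain at level `wL` on `[0, T]` for the weight `W`: consecutive `W`-valid two-prime cells from `0` to `T`,
and the level `wL ≤ W(t)` for `|t| ≥ T`. [folklore] -/
structure CellsOKW23 (wL T : ℚ) (cells : List TPDCell) (W : ℝ → ℝ) : Prop where
  /-- the cells form a chain from `0` to `T` -/
  chain : checkChain₂₃ cells 0 T = true
  /-- every cell is `W`-valid -/
  valid : ∀ c ∈ cells, CellValidW23 c W
  /-- the level beyond `T`: `wL ≤ W(t)` for `|t| ≥ T` -/
  level : ∀ t : ℝ, (T : ℝ) ≤ |t| → (wL : ℝ) ≤ W t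

/-- `checkChain₂₃` is `checkChain₂` on the first-prime parts. [folklore] -/
theorem checkChain₂₃_eq_map (cells : List TPDCell) (s T : ℚ) :
    checkChain₂₃ cells s T = checkChain₂ (cells.map TPDCell.fp) s T := by
  induction cells generalizing s with
  | nil => rfl
  | cons c cs ih => simp only [checkChain₂₃, List.map_cons, checkChain₂, ih]
section Chain

variable {wL : ℚ} {W : ℝ → ℝ}

/-- A chain of valid cells from `s` to `T` has `s ≤ T` and all cells inside `[s, T]`. [folklore] -/
theorem chain_bounds₂₃W {cells : List TPDCell} {s T : ℚ} (hchain : checkChain₂₃ cells s T = true)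
    (hall : ∀ c ∈ cells, CellValidW23 c W) :
    s ≤ T ∧ ∀ c ∈ cells, s ≤ c.fp.psi.u ∧ c.fp.psi.v ≤ T := by
  induction cells generalizing s with
  | nil =>
    simp only [checkChain₂₃, decide_eq_true_eq] at hchain
    exact ⟨hchain.le, fun c hc ↦ by simp at hc⟩
  | cons c cs ih =>
    simp only [checkChain₂₃, Bool.and_eq_true, decide_eq_true_eq] at hchain
    have hc := hall c (by simp)
    have huv := hc.u_lt_v
    have ih' := ih hchain.2 fun c' hc' ↦ hall c' (by simp [hc'])
    refine ⟨by rw [← hchain.1]; exact huv.le.trans ih'.1, fun c' hc' ↦ ?_⟩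
    simp only [List.mem_cons] at hc'
    rcases hc' with rfl | hc'
    · exact ⟨hchain.1.ge, ih'.1⟩
    · have := ih'.2 c' hc'
      exact ⟨hchain.1 ▸ huv.le.trans this.1, this.2⟩

/-- `γ_{≥0}` vanishes off `[s, T)`. [folklore] -/
theorem gammaAux₂₃_eq_zeroW {cells : List TPDCell} {s T : ℚ} (hchain : checkChain₂₃ cells s T = true)
    (hall : ∀ c ∈ cells, CellValidW23 c W) {x : ℝ} (hx : x < s ∨ (T : ℝ) ≤ x) :
    gammaAux₂₃ wL cells x = 0 := by
  induction cells generalizing s with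
  | nil => rfl
  | cons c cs ih =>
    have hb := chain_bounds₂₃W hchain hall
    simp only [checkChain₂₃, Bool.and_eq_true, decide_eq_true_eq] at hchain
    have hcv : (c.fp.psi.v : ℝ) ≤ T := by exact_mod_cast (hb.2 c (by simp)).2
    have huv : (c.fp.psi.u : ℝ) < c.fp.psi.v := by exact_mod_cast (hall c (by simp)).u_lt_v
    have hus : (c.fp.psi.u : ℝ) = s := by exact_mod_cast hchain.1
    simp only [gammaAux₂₃]
    rw [ih hchain.2 (fun c' hc' ↦ hall c' (by simp [hc'])) ?_, add_zero, Set.indicator_of_notMem]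
    · rintro ⟨h1, h2⟩
      rcases hx with hx | hx <;> linarith
    · rcases hx with hx | hx
      · left; linarith
      · right; exact hx

/-- On `[s, T)`, `γ_{≥0}(x) = wL − σ_j(x)` for the cell containing `x`. [folklore] -/
theorem gammaAux₂₃_specW {cells : List TPDCell} {s T : ℚ} (hchain : checkChain₂₃ cells s T = true)
    (hall : ∀ c ∈ cells, CellValidW23 c W) {x : ℝ} (h1 : (s : ℝ) ≤ x) (h2 : x < T) :
    ∃ c ∈ cells, (c.fp.psi.u : ℝ) ≤ x ∧ x < c.fp.psi.v ∧
      gammaAux₂₃ wL cells x = wL - c.sigma x := by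
  induction cells generalizing s with
  | nil =>
    simp only [checkChain₂₃, decide_eq_true_eq] at hchain
    rw [hchain] at h1
    linarith
  | cons c cs ih =>
    simp only [checkChain₂₃, Bool.and_eq_true, decide_eq_true_eq] at hchain
    have hus : (c.fp.psi.u : ℝ) = s := by exact_mod_cast hchain.1
    have hall' : ∀ c' ∈ cs, CellValidW23 c' W := fun c' hc' ↦ hall c' (by simp [hc'])
    by_cases hxv : x < c.fp.psi.v
    · refine ⟨c, by simp, by linarith, hxv, ?_⟩
      simp only [gammaAux₂₃]
      have hmem : x ∈ Ico (c.fp.psi.u : ℝ) c.fp.psi.v := ⟨by linarith, hxv⟩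
      rw [gammaAux₂₃_eq_zeroW hchain.2 hall' (Or.inl hxv), add_zero, Set.indicator_of_mem hmem]
    · push Not at hxv
      obtain ⟨c', hc', hr⟩ := ih hchain.2 hall' hxv
      refine ⟨c', by simp [hc'], hr.1, hr.2.1, ?_⟩
      simp only [gammaAux₂₃]
      rw [Set.indicator_of_notMem (fun h ↦ not_lt.2 hxv h.2), zero_add, hr.2.2]

end Chain

section Sound

variable {wL T : ℚ} {cells : List TPDCell} {W : ℝ → ℝ}

/-- **Soundness of a certified two-prime minorant of an even weight `W`.** `wL − γ(t) ≤ W(t)` for all real `t`. [folklore] -/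
theorem level_sub_cellsGamma₂₃_leW (h : CellsOKW23 wL T cells W) (heven : ∀ t, W (-t) = W t) (t : ℝ) :
    (wL : ℝ) - cellsGamma₂₃ wL cells t ≤ W t := by
  have hchain := h.chain
  have hall := h.valid
  unfold cellsGamma₂₃
  have hx0 : (0 : ℝ) ≤ |t| := abs_nonneg t
  rcases lt_or_ge |t| (T : ℝ) with hxT | hxT
  · obtain ⟨c, hc, hux, hxv, hval⟩ := gammaAux₂₃_specW hchain hall (by exact_mod_cast hx0) hxT
    rw [hval, sub_sub_cancel]
    have h1 := (hall c hc).sigma_le hux hxv.le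
    have e : W |t| = W t := by
      rcases abs_choice t with h' | h'
      · rw [h']
      · rw [h', heven]
    rwa [e] at h1
  · rw [gammaAux₂₃_eq_zeroW hchain hall (Or.inr hxT), sub_zero]
    exact h.level t hxT

/-- `γ(t) = 0` for `|t| ≥ T`. [folklore] -/
theorem cellsGamma₂₃_eq_zeroW (h : CellsOKW23 wL T cells W) {t : ℝ} (ht : (T : ℝ) ≤ |t|) :
    cellsGamma₂₃ wL cells t = 0 :=
  gammaAux₂₃_eq_zeroW h.chain h.valid (Or.inr ht)

end Sound

/-! ## The step majorant of `|γ|` -/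

/-- `|γ_{≥0}(s)| ≤ step(s)` when all cells are `W`-valid. [folklore] -/
theorem abs_gammaAux₂₃_le_stepW {wL : ℚ} {cells : List TPDCell} {W : ℝ → ℝ}
    (hall : ∀ c ∈ cells, CellValidW23 c W) (s : ℝ) :
    |gammaAux₂₃ wL cells s| ≤ stepAux₂₃ wL cells s := by
  induction cells with
  | nil => simp [gammaAux₂₃, stepAux₂₃]
  | cons c cs ih =>
    simp only [gammaAux₂₃, stepAux₂₃]
    refine (abs_add_le _ _).trans (add_le_add ?_ (ih fun c' hc' ↦ hall c' (by simp [hc'])))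
    by_cases hs : s ∈ Ico (c.fp.psi.u : ℝ) c.fp.psi.v
    · rw [Set.indicator_of_mem hs, Set.indicator_of_mem hs]
      exact (hall c (by simp)).abs_sub_le wL hs.1 hs.2.le
    · rw [Set.indicator_of_notMem hs, Set.indicator_of_notMem hs, abs_zero]

/-- `step` is bounded, nonnegative and measurable. [folklore] -/
theorem stepAux₂₃_propsW {wL : ℚ} {cells : List TPDCell} {W : ℝ → ℝ} (hall : ∀ c ∈ cells, CellValidW23 c W) :
    (∃ B, ∀ s, 0 ≤ stepAux₂₃ wL cells s ∧ stepAux₂₃ wL cells s ≤ B) ∧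
      Measurable (stepAux₂₃ wL cells) := by
  induction cells with
  | nil => exact ⟨⟨0, fun s ↦ by simp [stepAux₂₃]⟩, measurable_const⟩
  | cons c cs ih =>
    obtain ⟨⟨B, hB⟩, hm⟩ := ih fun c' hc' ↦ hall c' (by simp [hc'])
    have hb0 : (0 : ℝ) ≤ ((c.bndQ wL : ℚ) : ℝ) := by
      exact_mod_cast (hall c (by simp)).bndQ_nonneg wL
    refine ⟨⟨((c.bndQ wL : ℚ) : ℝ) + B, fun s ↦ ?_⟩, ?_⟩
    · simp only [stepAux₂₃]
      by_cases hs : s ∈ Ico (c.fp.psi.u : ℝ) c.fp.psi.v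
      · rw [Set.indicator_of_mem hs]; exact ⟨add_nonneg hb0 (hB s).1, add_le_add le_rfl (hB s).2⟩
      · rw [Set.indicator_of_notMem hs, zero_add]
        exact ⟨(hB s).1, (hB s).2.trans (by linarith)⟩
    · change Measurable fun s ↦
        Set.indicator (Ico (c.fp.psi.u : ℝ) c.fp.psi.v) (fun _ ↦ ((c.bndQ wL : ℚ) : ℝ)) s +
          stepAux₂₃ wL cs s
      exact (measurable_const.indicator measurableSet_Ico).add hm

/-- **Moments of the step bound.** `s ↦ step(s) s^q` is integrable and `∫ step(s) s^q ds = cellsAbsMomentQ₂₃ wL cells q`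
(`W`-valid cells). [folklore] -/
theorem integral_stepAux₂₃_mul_powW {wL : ℚ} {cells : List TPDCell} {W : ℝ → ℝ}
    (hall : ∀ c ∈ cells, CellValidW23 c W) (q : ℕ) :
    Integrable (fun s ↦ stepAux₂₃ wL cells s * s ^ q) ∧
      ∫ s, stepAux₂₃ wL cells s * s ^ q = (cellsAbsMomentQ₂₃ wL cells q : ℝ) := by
  induction cells with
  | nil => simp [stepAux₂₃, cellsAbsMomentQ₂₃]
  | cons c cs ih =>
    obtain ⟨ihi, ihv⟩ := ih fun c' hc' ↦ hall c' (by simp [hc'])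
    have huv : (c.fp.psi.u : ℝ) ≤ c.fp.psi.v := by exact_mod_cast ((hall c (by simp)).u_lt_v).le
    have e : (fun s ↦ stepAux₂₃ wL (c :: cs) s * s ^ q) = fun s ↦
        Set.indicator (Ico (c.fp.psi.u : ℝ) c.fp.psi.v) (fun s ↦ ((c.bndQ wL : ℚ) : ℝ) * s ^ q) s +
          stepAux₂₃ wL cs s * s ^ q := by
      funext s
      simp only [stepAux₂₃, add_mul, Set.indicator_mul_left]
    rw [e]
    have i1 : Integrable fun s : ℝ ↦
        Set.indicator (Ico (c.fp.psi.u : ℝ) c.fp.psi.v) (fun s ↦ ((c.bndQ wL : ℚ) : ℝ) * s ^ q) s := by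
      rw [integrable_indicator_iff measurableSet_Ico]
      exact ((continuous_const.mul (continuous_pow q)).continuousOn.integrableOn_Icc
        (a := (c.fp.psi.u : ℝ)) (b := c.fp.psi.v)).mono_set Ico_subset_Icc_self
    refine ⟨i1.add ihi, ?_⟩
    rw [integral_add i1 ihi, ihv, integral_indicator measurableSet_Ico, integral_Ico_eq_integral_Ioo,
      ← integral_Ioc_eq_integral_Ioo, ← intervalIntegral.integral_of_le huv,
      intervalIntegral.integral_const_mul, WeilCell.integral_pow_eq_powIntQ, cellsAbsMomentQ₂₃]
    push_cast
    ring

/-! ## Exact moments of the minorant -/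


section Moments

variable {wL : ℚ} {W : ℝ → ℝ}

/-- **Moments of `γ_{≥0}`.** `s ↦ γ_{≥0}(s) s^q` is integrable and `∫ γ_{≥0}(s) s^q ds = Σ_j momentQ_j`
(`W`-valid cells). [folklore] -/
theorem integral_gammaAux₂₃_mul_powW {cells : List TPDCell} (hall : ∀ c ∈ cells, CellValidW23 c W)
    (q : ℕ) :
    Integrable (fun s ↦ gammaAux₂₃ wL cells s * s ^ q) ∧
      ∫ s, gammaAux₂₃ wL cells s * s ^ q = (cellsMomentQ₂₃ wL cells q : ℝ) := by
  induction cells with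
  | nil => simp [gammaAux₂₃, cellsMomentQ₂₃]
  | cons c cs ih =>
    obtain ⟨ihi, ihv⟩ := ih fun c' hc' ↦ hall c' (by simp [hc'])
    have huv : (c.fp.psi.u : ℝ) ≤ c.fp.psi.v := by exact_mod_cast ((hall c (by simp)).u_lt_v).le
    have e : (fun s ↦ gammaAux₂₃ wL (c :: cs) s * s ^ q) = fun s ↦
        Set.indicator (Ico (c.fp.psi.u : ℝ) c.fp.psi.v) (fun s ↦ ((wL : ℝ) - c.sigma s) * s ^ q) s +
          gammaAux₂₃ wL cs s * s ^ q := by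
      funext s
      simp only [gammaAux₂₃, add_mul, Set.indicator_mul_left]
    rw [e]
    have i1 := integrable_indicator_cell₂₃ wL c q
    refine ⟨i1.add ihi, ?_⟩
    rw [integral_add i1 ihi, ihv, integral_indicator measurableSet_Ico, integral_Ico_eq_integral_Ioo,
      ← integral_Ioc_eq_integral_Ioo, ← intervalIntegral.integral_of_le huv,
      TPDCell.integral_level_sub_sigma_mul_pow, cellsMomentQ₂₃]
    push_cast
    ring

variable {T : ℚ} {cells : List TPDCell}

/-- **Moments of `γ`.** For even `q`, `t ↦ γ(t) t^q` is integrable and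
`∫ γ(t) t^q dt = 2 Σ_j momentQ_j(q)`. [folklore] -/
theorem integral_cellsGamma₂₃_mul_powW (h : CellsOKW23 wL T cells W) {q : ℕ} (hq : Even q) :
    Integrable (fun t ↦ cellsGamma₂₃ wL cells t * t ^ q) ∧
      ∫ t, cellsGamma₂₃ wL cells t * t ^ q = 2 * (cellsMomentQ₂₃ wL cells q : ℝ) := by
  have hchain := h.chain
  have hall := h.valid
  obtain ⟨hFi, hFv⟩ := integral_gammaAux₂₃_mul_powW hall q
  set F : ℝ → ℝ := fun s ↦ gammaAux₂₃ wL cells s * s ^ q with hF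
  have hev : (fun t ↦ cellsGamma₂₃ wL cells t * t ^ q) = fun t ↦ F |t| := by
    funext t
    rw [hF, cellsGamma₂₃]
    simp only
    rw [hq.pow_abs]
  rw [hev]
  -- support of `F` is in `[0, T]`
  have hF0 : ∀ s, s ∉ Ici (0 : ℝ) → F s = 0 := fun s hs ↦ by
    rw [hF]
    simp only
    rw [gammaAux₂₃_eq_zeroW hchain hall (Or.inl (by simpa using hs)), zero_mul]
  constructor
  · -- integrability of `F ∘ |·|`: bounded with compact support, measurable
    obtain ⟨B, hB⟩ := exists_abs_gammaAux₂₃_le wL cells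
    have hT0 : (0 : ℝ) ≤ T := by exact_mod_cast (chain_bounds₂₃W hchain hall).1
    have hmeas : Measurable fun t ↦ F |t| := by
      rw [hF]
      exact ((measurable_gammaAux₂₃ wL cells).mul (measurable_id.pow_const q)).comp
        continuous_abs.measurable
    have hconst : IntegrableOn (fun _ : ℝ ↦ B * (T : ℝ) ^ q) (Icc (-(T : ℝ)) T) :=
      integrableOn_const measure_Icc_lt_top.ne
    refine Integrable.mono' ((integrable_indicator_iff measurableSet_Icc).2 hconst)
      hmeas.aestronglyMeasurable (Eventually.of_forall fun t ↦ ?_)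
    by_cases ht : |t| < T
    · have hmem : t ∈ Icc (-(T : ℝ)) T := ⟨by linarith [neg_abs_le t], by linarith [le_abs_self t]⟩
      rw [Set.indicator_of_mem hmem, hF, Real.norm_eq_abs]
      simp only
      rw [abs_mul, abs_pow, abs_abs]
      exact mul_le_mul (hB _) (pow_le_pow_left₀ (abs_nonneg t) ht.le q) (by positivity)
        ((abs_nonneg _).trans (hB 0))
    · push Not at ht
      rw [hF, Real.norm_eq_abs]
      simp only
      rw [gammaAux₂₃_eq_zeroW hchain hall (Or.inr ht), zero_mul, abs_zero]
      exact Set.indicator_nonneg (fun _ _ ↦ by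
        have := (abs_nonneg _).trans (hB 0); positivity) _
  · rw [integral_comp_abs (f := F), ← integral_Ici_eq_integral_Ioi,
      setIntegral_eq_integral_of_forall_compl_eq_zero hF0, hFv]

end Moments

end Summit.Ventures.WeilGRH

end
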